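import Literature.AlgebraicGeometry.HodgeTheory.SupportedLocusClosed
import Literature.AlgebraicGeometry.Motives.AlgebraicEquivalenceFibreDimension
import Literature.AlgebraicGeometry.Motives.AlgebraicEquivalenceFlatPullbackFiniteTypeProofs
import Literature.AlgebraicGeometry.Motives.FlatOverSmoothCurve
import Literature.AlgebraicGeometry.Motives.VarietiesDimensionProofs
import Mathlib.AlgebraicGeometry.Morphisms.UniversallyOpen
import HarnessLib

/-!
# Limits of supported classes along curves (Charles–Schnell 2014, proof of Prop. 11.3.11, step 3)

Topic `Literature/AlgebraicGeometry/HodgeTheory` (family `hodge`), third proof file towards the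
named fact `charlesSchnell_algebraicityLocus_iUnion_closed` (`AlgebraicityLocus.lean`: the
algebraicity locus `{t ∈ S(ℂ) | A|_{𝒳_t} ∈ algebraicClasses (𝒳_t) p}` of a global class on a smooth
projective family over a smooth quasi-projective base is a countable union of sets of complex
points of Zariski-closed subsets), after `AlgebraicityLocusParametrised` (bookkeeping: proper
parameter spaces with closed good sets give the conclusion) and `SupportedLocusClosed` (the good
sets `{y | A|_{𝒳_{g(y)}} dies off Z_y}` of a Zariski-closed family of supports are closed in the
strong topology, and supportedness passes to Zariski closures of locally constructible sets of
parameters, SGA1 XII 2.2).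

The printed proof (Charles–Schnell, *Notes on absolute Hodge classes*, proof of Prop. 11.3.11;
Voisin, *Hodge Theory II*, §3.3.1 and proof of Thm. 7.19) closes the images of the components of the
relative Hilbert scheme using "a limit of codimension-`p` algebraic cycles is a codimension-`p`
algebraic cycle" (specialisation of cycles over a curve, Fulton §10.1, §20.3). In the tree
`algebraicClasses X p = supportedClasses X (2p) p` is defined by SUPPORTS (classes dying off a
Zariski-closed subset of codimension `≥ p`), so the specialisation statement needed is one about
supports, and this file PROVES it (sorry-free, no new facts):

* `exists_height_le_of_sliceAt_mem_closure` — **semicontinuity of codimension along a curve**: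
  for `T` a smooth integral curve, `𝒵₀ ⊆ 𝒳 × T` closed and `U ⊆ T` open, every point `x` of `𝒳`
  with `(x, y₁)` in the closure of `𝒵₀ ∩ pr_T⁻¹(U)` has `height x ≤ height x'` for some
  `(x', u) ∈ 𝒵₀` with `u` a complex point over `U`. The proof is the classical one: the component of the closure
  through `(x, y₁)`, with its reduced structure, is an integral closed subscheme `W` dominating
  `T`, hence FLAT over the smooth curve `T` (Hartshorne III.9.7, the tree's
  `Motives.flat_of_isDominant_of_smoothCurve`), so its image is open and contains complex points
  over `U`, and all fibres of `W → T` at complex points have the same dimension (Fulton §10.1, the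
  tree's `Motives.height_familyFiber_add_one_eq_of_isMax`);
* `mem_algebraicClasses_of_curve` — **limits of supported classes along a curve**: for
  `f : 𝒳 ⟶ S` a smooth projective family over a smooth quasi-projective base, `c : T ⟶ S` from a
  smooth integral quasi-compact curve, `𝒵₀ ⊆ 𝒳 × T` closed and `U ⊆ T` a non-empty open such that
  over every complex point `y` of `U` the slice `(𝒵₀)_y` has codimension `≥ p` and `A|_{𝒳_{c(y)}}`
  dies off it, the class `A|_{𝒳_{c(y₁)}}` is algebraic at EVERY complex point `y₁` of `T`
  (supported on the slice of `closure (𝒵₀ ∩ pr_T⁻¹ U)`, of codimension `≥ p` by the first result,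
  off which `A` dies by `SupportedLocusClosed.map_fiberι_mem_ker_restrictCompl_of_pt_mem_closure`).

Supporting lemmas (all folklore, proved): maximal points specialising to a given point
(`exists_isMax_specializes`), components of a Noetherian space meet dense sets, points of `𝒳 × T`
over a complex point are slices (`exists_sliceAt_base_eq`), heights under fibre inclusions and
slices, the dimension formula `height + coheight = n` on a smooth projective `n`-fold, closed
points of a smooth curve (`eq_of_specializes_of_ne_top`), dominance from two points
(`isDominant_of_apply_eq_of_apply_ne`), complex points in open images
(`exists_complexPoint_pt_mem_inter_range`).

What is NOT here: the existence of curves `T → H` through two given points of an irreducible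
parameter variety (Mumford, *Abelian Varieties* §6 Lemma; the tree's named fact
`Motives.mumford_smoothCurve_through_two_points`), and the generic structure of the good sets on an
irreducible parameter variety (EGA IV₃ 9.7.7), which together with this file and
`AlgebraicityLocusParametrised` assemble the named fact.

## References

* [CharlesSchnell2014Notes] F. Charles, C. Schnell, Notes on absolute Hodge classes, in Hodge
  Theory (Princeton Math. Notes 49, 2014), Prop. 11.3.11 (proof).
* [VoisinHodgeII2003] C. Voisin, Hodge Theory and Complex Algebraic Geometry II (2003), §3.3.1,
  §7.3.2 (proof of Thm. 7.19).
* [Fulton1998] W. Fulton, Intersection Theory, 2nd ed. (1998), §10.1, §20.3.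
* [Hartshorne1977] R. Hartshorne, Algebraic Geometry (1977), III Prop. 9.7, II Ex. 3.22.
* [SGA1] A. Grothendieck, M. Raynaud, Revêtements étales et groupe fondamental, Exp. XII Prop. 2.2.
* [StacksProject] The Stacks Project, Tag 0A21, Tag 02QQ.
-/

noncomputable section

open CategoryTheory AlgebraicGeometry Limits Set Order MonoidalCategory CartesianMonoidalCategory
open _root_.Topology
open Literature.AlgebraicGeometry.Motives

universe u

namespace Literature.AlgebraicGeometry.HodgeTheory

section HodgeTheory

/-! ### Generalities: maximal points, components meeting a dense open -/

/-- Every point of a scheme specialises from a maximal point (the generic point of an irreducible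
component through it; schemes are sober). [folklore] -/
theorem exists_isMax_specializes {X : Scheme.{u}} (x : X) : ∃ m : X, IsMax m ∧ m ⤳ x := by
  let K := irreducibleComponent x
  have hK : IsIrreducible K := isIrreducible_irreducibleComponent
  have hKc : IsClosed K := isClosed_irreducibleComponent
  let m := hK.genericPoint
  have hm : IsGenericPoint m K := by
    have h := hK.isGenericPoint_genericPoint_closure
    rwa [hKc.closure_eq] at h
  refine ⟨m, fun v hv => ?_, hm.specializes mem_irreducibleComponent⟩
  -- `v` generalises `m`: `closure {v} ⊇ K` is irreducible, hence `= K`, so `v ∈ K` and `m ⤳ v`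
  have hvm : v ⤳ m := Scheme.le_iff_specializes.1 hv
  have hsub : K ⊆ closure {v} := by
    rw [← hm.def]
    exact closure_minimal (singleton_subset_iff.2 (hvm.mem_closure)) isClosed_closure
  have heq : closure {v} = K :=
    eq_irreducibleComponent (isIrreducible_singleton.closure).isPreirreducible hsub
  have hvK : v ∈ K := heq ▸ subset_closure (mem_singleton v)
  exact Scheme.le_iff_specializes.2 (hm.specializes hvK)

/-- In a Noetherian topological space every irreducible component meets every dense subset (the
complement of the union of the other components is a non-empty open subset of the component).
[folklore] -/
theorem inter_nonempty_of_mem_irreducibleComponents_of_dense {α : Type*} [TopologicalSpace α]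
    [TopologicalSpace.NoetherianSpace α] {Z : Set α} (hZ : Z ∈ irreducibleComponents α)
    {O : Set α} (hOd : Dense O) : (Z ∩ O).Nonempty := by
  have hfin := TopologicalSpace.NoetherianSpace.finite_irreducibleComponents (α := α)
  set V : Set α := (⋃₀ (irreducibleComponents α \ {Z}))ᶜ with hV
  have hVo : IsOpen V := by
    rw [hV, Set.sUnion_eq_biUnion, isOpen_compl_iff]
    exact hfin.sdiff.isClosed_biUnion fun W hW => isClosed_of_mem_irreducibleComponents W hW.1
  have hVZ : V ⊆ Z := by
    intro v hv
    by_contra hvZ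
    obtain ⟨W, hW, hvW⟩ := Set.mem_sUnion.1
      ((sUnion_irreducibleComponents (X := α)).symm ▸ mem_univ v : v ∈ ⋃₀ irreducibleComponents α)
    exact hv (Set.mem_sUnion.2 ⟨W, ⟨hW, fun h => hvZ (h ▸ hvW)⟩, hvW⟩)
  have hVne : V.Nonempty := by
    by_contra hVe
    rw [not_nonempty_iff_eq_empty] at hVe
    have h := closure_sUnion_irreducibleComponents_sdiff_singleton hfin Z hZ
    rw [← hV, hVe, closure_empty] at h
    exact (hZ.1.nonempty.ne_empty h.symm)
  obtain ⟨v, hvV, hvO⟩ := hOd.inter_open_nonempty V hVo hVne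
  exact ⟨v, hVZ hvV, hvO⟩

/-! ### Slices of a closed subset of `𝒳 × T` over complex points of `T` -/

section Slices

variable {𝒳 S T : Motives.SchemeOver ℂ} (f : 𝒳 ⟶ S)

/-- Morphisms to `Spec ℂ` over `ℂ` are unique: any `g : X ⟶ Spec ℂ` over `Spec ℂ` is the
structure morphism `toSpecOver X` (`Spec ℂ` is terminal among `ℂ`-schemes). [folklore] -/
theorem eq_toSpecOver {k : Type u} [Field k] {X : Motives.SchemeOver k}
    (g : X ⟶ Motives.specOver k k) : g = toSpecOver X := by
  have hid : (Motives.specOver k k).hom = 𝟙 (Spec (.of k)) := by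
    simp only [Motives.specOver, Over.mk_hom, Algebra.algebraMap_self, CommRingCat.ofHom_id,
      Spec.map_id]
  have h : g.left ≫ (Motives.specOver k k).hom = X.hom := Over.w g
  rw [hid] at h
  erw [Category.comp_id] at h
  apply Over.OverMorphism.ext
  rw [toSpecOver_left]
  exact h

/-- The slice morphism of `SupportedLocusClosed` is the fibre inclusion followed by the slice
`i_y : 𝒳 ≅ 𝒳 × {y} ⟶ 𝒳 × T`: `(ι_t, y) = ι_t ≫ i_y`. [folklore] -/
theorem lift_fiberι_eq_fiberι_comp_sliceAt (t : Motives.ComplexPoints S)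
    (y : Motives.ComplexPoints T) :
    lift (Motives.fiberι f t) (Motives.fiberOverToSpec f t ≫ y) =
      Motives.fiberι f t ≫ sliceAt 𝒳 y := by
  rw [sliceAt, comp_lift, Category.comp_id, ← Category.assoc,
    eq_toSpecOver (Motives.fiberι f t ≫ toSpecOver 𝒳), eq_toSpecOver (Motives.fiberOverToSpec f t)]

/-- **Points of `𝒳 × T` over a complex point `y` of `T` are slices**: if `pr_T(w) = pt y` then
`w = i_y(x)` for a point `x` of `𝒳` (the slice `i_y` is the base change of `y : Spec ℂ → T`,
`Motives.isPullback_sliceAt`, whose image is `pr_T⁻¹(pt y)`). [folklore] -/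
theorem exists_sliceAt_base_eq (y : Motives.ComplexPoints T) (w : (𝒳 ⊗ T).left)
    (hw : (CartesianMonoidalCategory.snd 𝒳 T).left.base w = y.pt) :
    ∃ x : 𝒳.left, (sliceAt 𝒳 y).left.base x = w := by
  have h := isPullback_sliceAt (X := 𝒳) y
  have hmem : w ∈ Set.range
      (pullback.fst (CartesianMonoidalCategory.snd 𝒳 T).left y.toSpecHom).base := by
    rw [Scheme.Pullback.range_fst]
    exact ⟨IsLocalRing.closedPoint ℂ, hw.symm⟩
  obtain ⟨q, hq⟩ := hmem
  obtain ⟨x, hx⟩ := h.isoPullback.hom.surjective q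
  refine ⟨x, ?_⟩
  have hfac := congrArg (fun φ => φ.base x) h.isoPullback_hom_fst
  simp only [Scheme.Hom.comp_base, TopCat.coe_comp, Function.comp_apply] at hfac
  rw [← hfac, hx, hq]

/-- **Points of `𝒳` over a complex point `t` of `S` are points of the fibre `𝒳_t`**: if
`f(x) = pt t` then `x = ι_t(z)` for a point `z` of `Motives.fiberOver f t`. [folklore] -/
theorem exists_fiberι_base_eq (t : Motives.ComplexPoints S) (x : 𝒳.left)
    (hx : f.left.base x = t.pt) :
    ∃ z : (Motives.fiberOver f t).left, (Motives.fiberι f t).left.base z = x := by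
  have hmem : x ∈ Set.range (pullback.fst f.left t.toSpecHom).base := by
    rw [Scheme.Pullback.range_fst]
    exact ⟨IsLocalRing.closedPoint ℂ, hx.symm⟩
  exact hmem

end Slices

/-! ### Heights: fibre inclusions and slices preserve heights; the dimension formula on a fibre -/

section Heights

variable {𝒳 S T : Motives.SchemeOver ℂ} (f : 𝒳 ⟶ S)

/-- The fibre inclusion `ι_t : 𝒳_t ⟶ 𝒳` (a closed immersion: base change of the closed point
`t : Spec ℂ → S`, `S` locally of finite type) preserves heights of points. [folklore] -/
theorem height_fiberι_base_eq [LocallyOfFiniteType S.hom] (t : Motives.ComplexPoints S)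
    (z : (Motives.fiberOver f t).left) :
    height ((Motives.fiberι f t).left.base z) = height z := by
  haveI : IsClosedImmersion t.left := AlgPoints.isClosedImmersion_toSpecHom S t
  haveI : IsClosedImmersion (Motives.fiberι f t).left :=
    MorphismProperty.pullback_fst (P := @IsClosedImmersion) f.left t.left inferInstance
  exact height_base_eq_of_isClosedImmersion' _ z

/-- The slice `i_y : 𝒳 ⟶ 𝒳 × T` (a closed immersion, `Motives.isClosedImmersion_sliceAt_left`)
preserves heights of points. [folklore] -/
theorem height_sliceAt_base_eq [LocallyOfFiniteType T.hom] (y : Motives.ComplexPoints T)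
    (x : 𝒳.left) : height ((sliceAt 𝒳 y).left.base x) = height x := by
  haveI := isClosedImmersion_sliceAt_left (X := 𝒳) y
  exact height_base_eq_of_isClosedImmersion' _ x

/-- **The dimension formula on a smooth projective variety**: `height z + coheight z = n` for every
point `z` of a smooth projective `n`-dimensional `X` over `ℂ` (`dim closure {z} + codim = dim X`;
`X` is integral of dimension `n`). [cite: StacksProject, Tag 0A21] -/
theorem height_add_coheight_eq_of_isSmoothProjective {n : ℕ} {X : Motives.SchemeOver ℂ}
    (hX : Motives.IsSmoothProjective n X) (z : X.left) :
    height z + coheight z = (n : ℕ∞) := by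
  haveI : IsIntegral X.left := Motives.IsSmoothProjective.isIntegral_holds hX
  haveI := hX.smoothOfRelativeDimension
  haveI : Smooth X.hom := SmoothOfRelativeDimension.smooth n X.hom
  have h1 := Motives.Scheme.height_add_coheight_eq_height_top X.hom z
  have h2 : (height (⊤ : X.left) : WithBot ℕ∞) = (n : ℕ∞) := by
    rw [Order.height_top_eq_krullDim,
      ← Order.krullDim_eq_of_orderIso (irreducibleSetEquivPoints (α := X.left))]
    exact topologicalKrullDim_eq_of_smoothOfRelativeDimension X.hom (n := n)
  rw [h1]
  exact_mod_cast h2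

/-- On a smooth projective `n`-fold, `p ≤ codim z` iff `dim closure {z} + p ≤ n`. [folklore] -/
theorem le_coheight_iff_height_add_le {n : ℕ} {X : Motives.SchemeOver ℂ}
    (hX : Motives.IsSmoothProjective n X) (z : X.left) (p : ℕ) :
    (p : ℕ∞) ≤ coheight z ↔ height z + p ≤ (n : ℕ∞) := by
  have h := height_add_coheight_eq_of_isSmoothProjective hX z
  have hfin : height z ≠ ⊤ := by
    intro htop
    rw [htop, top_add] at h
    exact (ENat.coe_ne_top n h.symm)
  obtain ⟨a, ha⟩ := ENat.ne_top_iff_exists.1 hfin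
  have hfin' : coheight z ≠ ⊤ := by
    intro htop
    rw [htop, add_top] at h
    exact (ENat.coe_ne_top n h.symm)
  obtain ⟨b, hb⟩ := ENat.ne_top_iff_exists.1 hfin'
  rw [← ha, ← hb] at h
  have hab : a + b = n := by exact_mod_cast h
  rw [← ha, ← hb]
  constructor
  · intro hp
    have hp' : p ≤ b := by exact_mod_cast hp
    have : a + p ≤ n := by omega
    exact_mod_cast this
  · intro hp
    have hp' : a + p ≤ n := by exact_mod_cast hp
    have : p ≤ b := by omega
    exact_mod_cast this

end Heights

/-! ### Fibre dimension of an integral family over a smooth curve is constant (upper bound form) -/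

section FamilyOverCurve

variable {𝒳 T : Motives.SchemeOver ℂ} [LocallyOfFiniteType 𝒳.hom] [IsIntegral T.left]
  [SmoothOfRelativeDimension 1 T.hom] (W : ClosedSubscheme (𝒳 ⊗ T).left) [IsIntegral W.carrier]

/-- **The fibres of an integral family over a smooth curve have constant dimension** (upper bound
form): if `W ↪ 𝒳 × T` is integral and dominates the smooth integral curve `T` (so it is flat over
`T`, Hartshorne III.9.7 = the tree's `flat_of_isDominant_of_smoothCurve`), and some maximal point
of some fibre `W_u` has `height ≤ m`, then EVERY point of EVERY fibre `W_y` has `height ≤ m`: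
maximal points of the fibres all have height `dim W - 1` (the tree's
`height_familyFiber_add_one_eq_of_isMax`, Fulton §10.1), and every point specialises from a
maximal one. [cite: Fulton1998, §10.1] [cite: Hartshorne1977, III Prop. 9.7] -/
theorem height_familyFiber_le_of_isMax
    [IsDominant (W.ι ≫ (CartesianMonoidalCategory.snd 𝒳 T).left)]
    {u : Motives.ComplexPoints T} {w₀ : (familyFiber W u).carrier} (hw₀ : IsMax w₀)
    (y : Motives.ComplexPoints T) (w : (familyFiber W y).carrier) : height w ≤ height w₀ := by
  haveI : Flat (W.ι ≫ (CartesianMonoidalCategory.snd 𝒳 T).left) :=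
    flat_of_isDominant_of_smoothCurve T _
  obtain ⟨w₁, hw₁, hspec⟩ := exists_isMax_specializes w
  have h0 := height_familyFiber_add_one_eq_of_isMax W u w₀ hw₀
  have h1 := height_familyFiber_add_one_eq_of_isMax W y w₁ hw₁
  have hle : height w ≤ height w₁ := height_mono (Scheme.le_iff_specializes.2 hspec)
  have heq : height w₁ = height w₀ := by
    have h := h1.trans h0.symm
    exact WithTop.add_right_cancel (by exact ENat.coe_ne_top 1) h
  exact hle.trans heq.le

end FamilyOverCurve

/-! ### Smooth integral curves: points, dominance from two points, complex points in open images -/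

section Curve

variable {T : Motives.SchemeOver ℂ} [IsIntegral T.left] [SmoothOfRelativeDimension 1 T.hom]

/-- Over a locally Noetherian base, locally of finite type implies locally of finite
presentation. [folklore] -/
theorem locallyOfFinitePresentation_of_isLocallyNoetherian {X Y : Scheme.{u}} (g : X ⟶ Y)
    [IsLocallyNoetherian Y] [LocallyOfFiniteType g] : LocallyOfFinitePresentation g := by
  rw [HasRingHomProperty.iff_appLE (P := @LocallyOfFinitePresentation)]
  intro U V e
  haveI := IsLocallyNoetherian.component_noetherian (X := Y) U
  exact RingHom.FinitePresentation.of_finiteType.mp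
    (HasRingHomProperty.appLE @LocallyOfFiniteType g inferInstance U V e)

/-- A smooth integral curve is one-dimensional: `height ⊤ = 1` (the generic point has height `1`).
[cite: GortzWedhorn2020, Lemma 6.26] -/
theorem height_top_eq_one_of_smoothCurve : height (⊤ : T.left) = 1 := by
  have h : (height (⊤ : T.left) : WithBot ℕ∞) = ((1 : ℕ) : ℕ∞) := by
    rw [Order.height_top_eq_krullDim,
      ← Order.krullDim_eq_of_orderIso (irreducibleSetEquivPoints (α := T.left))]
    exact topologicalKrullDim_eq_of_smoothOfRelativeDimension T.hom (n := 1)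
  exact_mod_cast h

/-- On a smooth integral curve every point other than the generic point is closed: it specialises
only to itself. [folklore] -/
theorem eq_of_specializes_of_ne_top {η x : T.left} (hη : η ≠ ⊤) (h : η ⤳ x) : x = η := by
  by_contra hx
  have hlt : x < η := lt_iff_le_not_ge.2 ⟨Scheme.le_iff_specializes.2 h,
    fun h' => hx ((Scheme.le_iff_specializes.1 h').antisymm h).eq⟩
  have hηlt : η < ⊤ := lt_iff_le_not_ge.2 ⟨le_top,
    fun h' => hη ((Scheme.le_iff_specializes.1 h').antisymm
      (Scheme.le_iff_specializes.1 (le_top (a := η)))).eq⟩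
  have htop := height_top_eq_one_of_smoothCurve (T := T)
  have hfinη : height η < ⊤ :=
    lt_of_le_of_lt (height_mono (le_top (a := η))) (by rw [htop]; exact ENat.one_lt_top)
  have hfinx : height x < ⊤ := lt_of_le_of_lt (height_mono hlt.le) hfinη
  have h1 : height x < height η := height_strictMono hlt hfinx
  have h2 : height η < height (⊤ : T.left) := height_strictMono hηlt hfinη
  rw [htop] at h2
  have h3 : height η = 0 := Order.lt_one_iff.1 h2
  rw [h3] at h1
  exact not_lt_zero h1

/-- **Dominance from two points**: a morphism `g : W → T` from an integral scheme to a smooth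
integral curve whose image contains a point `a` and a point different from `a` is dominant (the
image of the generic point of `W` specialises to both, so it is not a closed point, hence is the
generic point of `T`). [folklore] -/
theorem isDominant_of_apply_eq_of_apply_ne {W : Scheme.{0}} [IsIntegral W] (g : W ⟶ T.left)
    {a : T.left} (w₁ w₂ : W) (h₁ : g.base w₁ = a) (h₂ : g.base w₂ ≠ a) : IsDominant g := by
  have hs₁ : g.base ⊤ ⤳ g.base w₁ := (genericPoint_specializes w₁).map g.continuous
  have hs₂ : g.base ⊤ ⤳ g.base w₂ := (genericPoint_specializes w₂).map g.continuous
  by_cases hη : g.base ⊤ = ⊤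
  · refine ⟨dense_iff_closure_eq.2 (Set.eq_univ_of_univ_subset ?_)⟩
    have h : closure {(⊤ : T.left)} ⊆ closure (Set.range g.base) :=
      closure_mono (Set.singleton_subset_iff.2 ⟨⊤, hη⟩)
    rwa [show closure {(⊤ : T.left)} = Set.univ from (genericPoint_spec T.left).def] at h
  · have e₁ := eq_of_specializes_of_ne_top hη hs₁
    have e₂ := eq_of_specializes_of_ne_top hη hs₂
    exact (h₂ (e₂.trans (e₁.symm.trans h₁))).elim

/-- **Complex points in the image of a dominant family over a curve.** For `g : W → T` dominant
and locally of finite type from an integral scheme to a smooth integral curve `T` locally of finite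
type over `ℂ`, and `U ⊆ T` a non-empty open, some COMPLEX point of `T` lies in `U` and in the
image of `g`: `g` is flat (Hartshorne III.9.7), hence open (flat and locally of finite
presentation), so its image is a non-empty open, which meets `U` (irreducibility) in an open set
containing a closed point (`T` is Jacobson), i.e. the point of a complex point
(`Motives.ComplexPoints.equivClosedPoints`). [cite: Hartshorne1977, III Prop. 9.7 and Ex. 9.1] -/
theorem exists_complexPoint_pt_mem_inter_range [LocallyOfFiniteType T.hom] {W : Scheme.{0}}
    [IsIntegral W] (g : W ⟶ T.left) [IsDominant g] [LocallyOfFiniteType g] (U : T.left.Opens)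
    (hU : (U : Set T.left).Nonempty) :
    ∃ u : Motives.ComplexPoints T, u.pt ∈ U ∧ u.pt ∈ Set.range g.base := by
  haveI : Flat g := flat_of_isDominant_of_smoothCurve T g
  haveI : IsLocallyNoetherian T.left := LocallyOfFiniteType.isLocallyNoetherian T.hom
  haveI : LocallyOfFinitePresentation g := locallyOfFinitePresentation_of_isLocallyNoetherian g
  have hopen : IsOpen (Set.range g.base) := g.isOpenMap.isOpen_range
  have hne : (Set.range g.base).Nonempty := Set.range_nonempty _
  have hne' : ((U : Set T.left) ∩ Set.range g.base).Nonempty :=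
    nonempty_preirreducible_inter U.2 hopen hU hne
  haveI : JacobsonSpace T.left := LocallyOfFiniteType.jacobsonSpace T.hom
  obtain ⟨x, hx, hxc⟩ := nonempty_inter_closedPoints hne' (U.2.inter hopen).isLocallyClosed
  set u := (Motives.ComplexPoints.equivClosedPoints T).symm ⟨x, hxc⟩ with hu
  have hupt : u.pt = x := by
    have h := Motives.ComplexPoints.coe_equivClosedPoints_apply T u
    rw [hu, Equiv.apply_symm_apply] at h
    exact h.symm
  exact ⟨u, hupt ▸ hx.1, hupt ▸ hx.2⟩

end Curve

/-! ### Semicontinuity of codimension along a curve, and the main theorem -/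

section MainCurve

variable {𝒳 S T : Motives.SchemeOver ℂ} (f : 𝒳 ⟶ S)

/-- `pr_T (i_y x) = pt y`: the slice at a complex point `y` lies over `y`. [folklore] -/
theorem snd_sliceAt_base (y : Motives.ComplexPoints T) (x : 𝒳.left) :
    (CartesianMonoidalCategory.snd 𝒳 T).left.base ((sliceAt 𝒳 y).left.base x) = y.pt := by
  have h : (sliceAt 𝒳 y ≫ CartesianMonoidalCategory.snd 𝒳 T).left.base x =
      (toSpecOver 𝒳 ≫ y).left.base x := by rw [sliceAt_snd]
  simp only [Over.comp_left, Scheme.Hom.comp_base, TopCat.coe_comp, Function.comp_apply] at h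
  rw [h]
  change _ = y.left.base (IsLocalRing.closedPoint ℂ)
  exact congrArg y.left.base (Subsingleton.elim (α := PrimeSpectrum ℂ) _ _)

/-- The slice morphism of `SupportedLocusClosed` on points: `(ι_t, y)(z) = i_y (ι_t z)`.
[folklore] -/
theorem lift_fiberι_base_apply (t : Motives.ComplexPoints S) (y : Motives.ComplexPoints T)
    (z : (Motives.fiberOver f t).left) :
    (lift (Motives.fiberι f t) (Motives.fiberOverToSpec f t ≫ y)).left.base z =
      (sliceAt 𝒳 y).left.base ((Motives.fiberι f t).left.base z) := by
  rw [lift_fiberι_eq_fiberι_comp_sliceAt]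
  rfl

/-- The total space of a smooth projective family over a quasi-projective base is of finite type
over `ℂ` (proper over an open subscheme of a projective scheme). [folklore] -/
theorem locallyOfFiniteType_and_quasiCompact_hom {n : ℕ}
    (hfam : Motives.IsSmoothProjectiveFamily f n) (hS : IsQuasiProjectiveOver S) :
    LocallyOfFiniteType 𝒳.hom ∧ QuasiCompact 𝒳.hom := by
  obtain ⟨P, j, hP, hj⟩ := hS
  haveI : IsProper P.hom := hP.isProper
  haveI : IsLocallyNoetherian P.left := LocallyOfFiniteType.isLocallyNoetherian P.hom
  haveI : IsProper f.left := hfam.isProper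
  have hXhom : 𝒳.hom = f.left ≫ j.left ≫ P.hom := by rw [← Over.w f, ← Over.w j]
  rw [hXhom]
  exact ⟨inferInstance, inferInstance⟩

/-- `𝒳 × T` is Noetherian for `𝒳` of finite type and `T` quasi-compact and locally of finite type
over `ℂ`. [folklore] -/
theorem isNoetherian_tensorObj_left [LocallyOfFiniteType 𝒳.hom] [QuasiCompact 𝒳.hom]
    [CompactSpace T.left] [LocallyOfFiniteType T.hom] : IsNoetherian (𝒳 ⊗ T).left := by
  haveI : LocallyOfFiniteType (𝒳 ⊗ T).hom :=
    inferInstanceAs (LocallyOfFiniteType (pullback.fst 𝒳.hom T.hom ≫ 𝒳.hom))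
  haveI : QuasiCompact (𝒳 ⊗ T).hom :=
    inferInstanceAs (QuasiCompact (pullback.fst 𝒳.hom T.hom ≫ 𝒳.hom))
  haveI : IsLocallyNoetherian (𝒳 ⊗ T).left :=
    LocallyOfFiniteType.isLocallyNoetherian (𝒳 ⊗ T).hom
  haveI : CompactSpace (𝒳 ⊗ T).left := QuasiCompact.compactSpace_of_compactSpace (𝒳 ⊗ T).hom
  exact {}

/-- **Semicontinuity of codimension along a curve** (the dimension count behind "limits of
algebraic cycles of codimension `p` have codimension `p`"). Let `T` be a smooth integral
quasi-compact curve over `ℂ`, `𝒵₀ ⊆ 𝒳 × T` Zariski-closed, `U ⊆ T` open, and let `x` be a point of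
`𝒳` whose slice `i_{y₁}(x) = (x, y₁)` at a complex point `y₁` lies in the Zariski closure of
`𝒵₀ ∩ pr_T⁻¹(U)`. Then `height x ≤ height x'` for some point `x'` with `(x', u) ∈ 𝒵₀` at a complex
point `u` OVER `U`. Proof: the irreducible component `C` of the closure through `(x, y₁)` meets the
dense open part over `U`; with its reduced structure it is an integral closed subscheme `W`
dominating `T` (its image contains `pt y₁ ∉ U` and a point of `U`; if `pt y₁ ∈ U` take `x' = x`),
hence flat over `T` (Hartshorne III.9.7) with open image containing a complex point `u` over `U`;
all fibres of `W → T` have the same dimension (Fulton §10.1,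
`Motives.height_familyFiber_add_one_eq_of_isMax`), so `x ∈ W_{y₁}` has height at most that of a
maximal point `x'` of `W_u ⊆ (𝒵₀)_u`. [cite: Fulton1998, §10.1]
[cite: Hartshorne1977, III Prop. 9.7] -/
theorem exists_height_le_of_sliceAt_mem_closure [LocallyOfFiniteType 𝒳.hom]
    [IsNoetherian (𝒳 ⊗ T).left] [IsIntegral T.left] [SmoothOfRelativeDimension 1 T.hom]
    (𝒵₀ : Set (𝒳 ⊗ T).left) (h𝒵₀ : IsClosed 𝒵₀) {U : Set T.left} (hUo : IsOpen U)
    (y₁ : Motives.ComplexPoints T) (x : 𝒳.left)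
    (hx : (sliceAt 𝒳 y₁).left.base x ∈
      closure (𝒵₀ ∩ (CartesianMonoidalCategory.snd 𝒳 T).left.base ⁻¹' U)) :
    ∃ (u : Motives.ComplexPoints T) (x' : 𝒳.left), u.pt ∈ U ∧
      (sliceAt 𝒳 u).left.base x' ∈ 𝒵₀ ∧ height x ≤ height x' := by
  haveI : Smooth T.hom := SmoothOfRelativeDimension.smooth 1 T.hom
  set 𝒵 : Set (𝒳 ⊗ T).left :=
    closure (𝒵₀ ∩ (CartesianMonoidalCategory.snd 𝒳 T).left.base ⁻¹' U)
  have h𝒵c : IsClosed 𝒵 := isClosed_closure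
  have h𝒵sub : 𝒵 ⊆ 𝒵₀ := closure_minimal Set.inter_subset_left h𝒵₀
  by_cases hy₁ : y₁.pt ∈ U
  · exact ⟨y₁, x, hy₁, h𝒵sub hx, le_rfl⟩
  -- the irreducible component `C` of `𝒵` through `w = (x, y₁)` meets the dense open part over `U`
  set w : (𝒳 ⊗ T).left := (sliceAt 𝒳 y₁).left.base x with hwdef
  let w' : ↥𝒵 := ⟨w, hx⟩
  let C : Set ↥𝒵 := irreducibleComponent w'
  have hC : C ∈ irreducibleComponents ↥𝒵 := irreducibleComponent_mem_irreducibleComponents w'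
  let O : Set ↥𝒵 := Subtype.val ⁻¹' ((CartesianMonoidalCategory.snd 𝒳 T).left.base ⁻¹' U)
  have hOd : Dense O := by
    rw [Subtype.dense_iff]
    refine closure_minimal (fun q hq => subset_closure ?_) isClosed_closure
    exact ⟨⟨q, subset_closure hq⟩, hq.2, rfl⟩
  obtain ⟨v, hvC, hvO⟩ := inter_nonempty_of_mem_irreducibleComponents_of_dense hC hOd
  -- `C` as a closed irreducible subset of `𝒳 × T`, its generic point, and the integral `W`
  have hCirr : IsIrreducible (Subtype.val '' C) :=
    isIrreducible_irreducibleComponent.image _ continuous_subtype_val.continuousOn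
  have hCcl : IsClosed (Subtype.val '' C) :=
    h𝒵c.isClosedEmbedding_subtypeVal.isClosedMap _ isClosed_irreducibleComponent
  have hζ : IsGenericPoint hCirr.genericPoint (Subtype.val '' C) :=
    hCirr.isGenericPoint_genericPoint hCcl
  set W : ClosedSubscheme (𝒳 ⊗ T).left :=
    (ClosedSubvariety.ofPoint (𝒳 ⊗ T).left hCirr.genericPoint).toClosedSubscheme
  have hWrange : Set.range W.ι.base = Subtype.val '' C :=
    (ClosedSubvariety.range_ofPoint_ι (X := (𝒳 ⊗ T).left) hCirr.genericPoint).trans hζ.def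
  -- two points of `W`: one over `pt y₁ ∉ U`, one over `U`; hence `W` dominates `T`
  have hwC : w ∈ Subtype.val '' C := ⟨w', mem_irreducibleComponent, rfl⟩
  obtain ⟨a, ha⟩ : w ∈ Set.range W.ι.base := by rw [hWrange]; exact hwC
  obtain ⟨b, hb⟩ : (v : (𝒳 ⊗ T).left) ∈ Set.range W.ι.base := by rw [hWrange]; exact ⟨v, hvC, rfl⟩
  have hsnd_a : (W.ι ≫ (CartesianMonoidalCategory.snd 𝒳 T).left).base a = y₁.pt := by
    simp only [Scheme.Hom.comp_base, TopCat.coe_comp, Function.comp_apply]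
    rw [ha, hwdef]
    exact snd_sliceAt_base y₁ x
  have hsnd_b : (W.ι ≫ (CartesianMonoidalCategory.snd 𝒳 T).left).base b ≠ y₁.pt := by
    intro h
    apply hy₁
    rw [← h]
    simp only [Scheme.Hom.comp_base, TopCat.coe_comp, Function.comp_apply]
    rw [hb]
    exact hvO
  haveI : IsDominant (W.ι ≫ (CartesianMonoidalCategory.snd 𝒳 T).left) :=
    isDominant_of_apply_eq_of_apply_ne _ a b hsnd_a hsnd_b
  haveI : LocallyOfFiniteType (CartesianMonoidalCategory.snd 𝒳 T).left :=
    inferInstanceAs (LocallyOfFiniteType (pullback.snd 𝒳.hom T.hom))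
  -- a complex point `u` over `U` in the (open) image of `W`, and a maximal point of `W_u`
  obtain ⟨u, huU, b', hb'⟩ := exists_complexPoint_pt_mem_inter_range
    (W.ι ≫ (CartesianMonoidalCategory.snd 𝒳 T).left) ⟨U, hUo⟩ ⟨_, hvO⟩
  obtain ⟨wu, -⟩ := exists_fst_familyFiber_eq W u b' hb'
  obtain ⟨w₀, hw₀, -⟩ := exists_isMax_specializes wu
  -- `x` is a point of `W_{y₁}`
  obtain ⟨a₁, ha₁⟩ : x ∈ Set.range (familyFiber W y₁).ι.base := by
    rw [range_familyFiber_ι]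
    exact ⟨a, ha⟩
  have h1 : height x = height a₁ := by
    rw [← ha₁]
    exact height_base_eq_of_isClosedImmersion' _ a₁
  have h2 : height a₁ ≤ height w₀ := height_familyFiber_le_of_isMax W hw₀ y₁ a₁
  -- `x' := ι_u w₀` has `(x', u) ∈ W ⊆ 𝒵 ⊆ 𝒵₀`
  have h3 : height ((familyFiber W u).ι.base w₀) = height w₀ :=
    height_base_eq_of_isClosedImmersion' _ w₀
  have hx'𝒵 : (sliceAt 𝒳 u).left.base ((familyFiber W u).ι.base w₀) ∈ 𝒵 := by
    have hr : (sliceAt 𝒳 u).left.base ((familyFiber W u).ι.base w₀) ∈ Set.range W.ι.base := by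
      have h : (familyFiber W u).ι.base w₀ ∈ Set.range (familyFiber W u).ι.base := ⟨w₀, rfl⟩
      rw [range_familyFiber_ι] at h
      exact h
    rw [hWrange] at hr
    obtain ⟨q, -, hq⟩ := hr
    rw [← hq]
    exact q.2
  exact ⟨u, (familyFiber W u).ι.base w₀, huU, h𝒵sub hx'𝒵, h1.le.trans (h2.trans h3.symm.le)⟩

/-- **Limits of supported classes along a curve** (Charles–Schnell, proof of Prop. 11.3.11: "the
limit of a family of codimension-`p` cycles is a codimension-`p` cycle", in the tree's support
language, where `algebraicClasses = supportedClasses _ (2p) p`). Let `f : 𝒳 ⟶ S` be a smooth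
projective family of relative dimension `n` over a smooth quasi-projective base, `c : T ⟶ S` a
morphism from a smooth integral quasi-compact curve, `𝒵₀ ⊆ 𝒳 × T` Zariski-closed, `U ⊆ T` a
non-empty open, and `A ∈ H²ᵖ(𝒳(ℂ); ℂ)`. Suppose that for every complex point `y` over `U` the slice
`(𝒵₀)_y ⊆ 𝒳_{c(y)}` has codimension `≥ p` (as `height + p ≤ n` on `𝒳`) and `A|_{𝒳_{c(y)}}` dies
off `(𝒵₀)_y`. Then `A|_{𝒳_{c(y₁)}}` is algebraic (supported in codimension `p`) at EVERY complex
point `y₁` of `T`: it dies off the slice of `𝒵 = closure (𝒵₀ ∩ pr_T⁻¹ U)` at `y₁` (strong closedness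
of the good set, `SupportedLocusClosed`, and SGA1 XII 2.2), and that slice has codimension `≥ p`
(`exists_height_le_of_sliceAt_mem_closure`). [cite: CharlesSchnell2014Notes, Prop. 11.3.11 (proof)]
[cite: VoisinHodgeII2003, §3.3.1 and §7.3.2] [cite: Fulton1998, §10.1] -/
theorem mem_algebraicClasses_of_curve {n : ℕ} (hfam : Motives.IsSmoothProjectiveFamily f n)
    (hS : IsQuasiProjectiveOver S) (hSsm : Smooth S.hom) [IsIntegral T.left]
    [SmoothOfRelativeDimension 1 T.hom] [CompactSpace T.left] (c : T ⟶ S) (p : ℕ)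
    (A : complexBetti 𝒳 (2 * p)) {𝒵₀ : Set (𝒳 ⊗ T).left} (h𝒵₀ : IsClosed 𝒵₀) {U : Set T.left}
    (hUo : IsOpen U) (hU : U.Nonempty)
    (hcodim : ∀ y : Motives.ComplexPoints T, y.pt ∈ U → ∀ x : 𝒳.left,
      (sliceAt 𝒳 y).left.base x ∈ 𝒵₀ → height x + p ≤ (n : ℕ∞))
    (hgood : ∀ y : Motives.ComplexPoints T, y.pt ∈ U →
      complexBetti.map (Motives.fiberι f (AlgPoints.map c y)) (2 * p) A ∈
        LinearMap.ker (complexBetti.restrictCompl (Motives.fiberOver f (AlgPoints.map c y))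
          ((lift (Motives.fiberι f (AlgPoints.map c y))
            (Motives.fiberOverToSpec f (AlgPoints.map c y) ≫ y)).left.base ⁻¹' 𝒵₀) (2 * p)).hom)
    (y₁ : Motives.ComplexPoints T) :
    complexBetti.map (Motives.fiberι f (AlgPoints.map c y₁)) (2 * p) A ∈
      algebraicClasses (Motives.fiberOver f (AlgPoints.map c y₁)) p := by
  -- instances on `S`, `T`, `𝒳` and `𝒳 × T`
  haveI : Smooth S.hom := hSsm
  haveI : Smooth T.hom := SmoothOfRelativeDimension.smooth 1 T.hom
  haveI : IsLocallyNoetherian T.left := LocallyOfFiniteType.isLocallyNoetherian T.hom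
  obtain ⟨h𝒳ft, h𝒳qc⟩ := locallyOfFiniteType_and_quasiCompact_hom f hfam hS
  haveI := h𝒳ft
  haveI := h𝒳qc
  haveI : IsNoetherian (𝒳 ⊗ T).left := isNoetherian_tensorObj_left
  -- the closure `𝒵` of the part of `𝒵₀` over `U`; over `U` it agrees with `𝒵₀`
  set 𝒵 : Set (𝒳 ⊗ T).left :=
    closure (𝒵₀ ∩ (CartesianMonoidalCategory.snd 𝒳 T).left.base ⁻¹' U)
  have h𝒵c : IsClosed 𝒵 := isClosed_closure
  have h𝒵sub : 𝒵 ⊆ 𝒵₀ := closure_minimal Set.inter_subset_left h𝒵₀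
  have h𝒵U : ∀ w, (CartesianMonoidalCategory.snd 𝒳 T).left.base w ∈ U → (w ∈ 𝒵 ↔ w ∈ 𝒵₀) :=
    fun w hw => ⟨fun h => h𝒵sub h, fun h => subset_closure ⟨h, hw⟩⟩
  -- (a) `A` dies off the slice of `𝒵` at EVERY complex point (Zariski-closure step)
  have hgood𝒵 : ∀ y : Motives.ComplexPoints T,
      complexBetti.map (Motives.fiberι f (AlgPoints.map c y)) (2 * p) A ∈
        LinearMap.ker (complexBetti.restrictCompl (Motives.fiberOver f (AlgPoints.map c y))
          ((lift (Motives.fiberι f (AlgPoints.map c y))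
            (Motives.fiberOverToSpec f (AlgPoints.map c y) ≫ y)).left.base ⁻¹' 𝒵) (2 * p)).hom := by
    intro y
    refine map_fiberι_mem_ker_restrictCompl_of_pt_mem_closure f hfam hS hSsm c h𝒵c (2 * p) A
      (Literature.NumberTheory.Transcendental.isLocallyConstructible_of_isOpen hUo) ?_ y ?_
    · intro y' hy'
      have heq : (lift (Motives.fiberι f (AlgPoints.map c y'))
            (Motives.fiberOverToSpec f (AlgPoints.map c y') ≫ y')).left.base ⁻¹' 𝒵 =
          (lift (Motives.fiberι f (AlgPoints.map c y'))
            (Motives.fiberOverToSpec f (AlgPoints.map c y') ≫ y')).left.base ⁻¹' 𝒵₀ := by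
        ext z
        simp only [Set.mem_preimage]
        apply h𝒵U
        rw [lift_fiberι_base_apply, snd_sliceAt_base]
        exact hy'
      rw [heq]
      exact hgood y' hy'
    · rw [(hUo.dense hU).closure_eq]
      exact Set.mem_univ _
  -- (b) the slice of `𝒵` at `y₁` has codimension `≥ p`; (c) conclude
  refine mem_supportedClasses_of_restrictCompl_eq_zero
    (h𝒵c.preimage (lift (Motives.fiberι f (AlgPoints.map c y₁))
      (Motives.fiberOverToSpec f (AlgPoints.map c y₁) ≫ y₁)).left.continuous) ?_
    (LinearMap.mem_ker.1 (hgood𝒵 y₁))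
  intro z hz
  rw [le_coheight_iff_height_add_le (hfam.isSmoothProjective (AlgPoints.map c y₁)) z p,
    ← height_fiberι_base_eq f (AlgPoints.map c y₁) z]
  rw [Set.mem_preimage, lift_fiberι_base_apply] at hz
  obtain ⟨u, x', huU, hx', hle⟩ := exists_height_le_of_sliceAt_mem_closure 𝒵₀ h𝒵₀ hUo y₁ _ hz
  exact (add_le_add hle le_rfl).trans (hcodim u huU x' hx')

end MainCurve

end HodgeTheory

end Literature.AlgebraicGeometry.HodgeTheory

end
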